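/-
Copyright: the b2b-balaban T⁴-continuum CRUX team, row NE7b OWNER lineage `t4-ne7b-p1` (gen 135). Project licence.
-/
import Summits.QuantumFields.BalabanUV.T4Continuum.Spine.NE7b.SupPolymerLocalStep

/-!
# THE BLOCKED SINGLETON TERM IS THE LOGARITHM OF THE UNEXPANDED SINGLE-BLOCK FACTOR: for the road's step (355) on a family `𝒳` of
# `R`-connected cell sets and a block `D` (a fibre `B⁻¹(p')` of a blocking map `B : V → W`), the output support terms `K⁺_Y(ψ)` with support
# INSIDE the block re-index EXACTLY to the step of the restricted family `𝒳|_D := {X ∈ 𝒳 : X ⊆ D}`: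
#   `Σ_{Y ∈ 𝒫(⋃𝒳), Y ⊆ D} K⁺_Y[𝒳](ψ) = Σ_{Y ∈ 𝒫(⋃𝒳|_D)} K⁺_Y[𝒳|_D](ψ)`   (pure algebra: every cluster with union inside `D` is a cluster of the
# restricted gas, with the same activities and the same truncated functional), hence, at small `ψ`, by (355)'s `step_exp_sum_support` for `𝒳|_D`,
#   `exp(K'_{{p'}}(ψ)) = exp(Σ_{Y : B(Y) = {p'}} K⁺_Y(ψ)) = Z_ψ(𝒳|_{B⁻¹p'}) = ∫∏_{X∈𝒳, X ⊆ B⁻¹p'}(1 + f_X(ω+ψ))dN(0,Γ)(ω)`: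
# the next singleton Mayer factor `e^{K'_{{p'}}} − 1` of (367)'s blocked ledger IS the unexpanded single-block factor `g⁺_{p'}` whose all-`ψ`
# regulated letter is (371)∕(372) — the object measured at small `ψ` by the ledger and the object regulated at every `ψ` are ONE object
# (SCOPING-d6′ (L4), the identification; row NE7b, node U5c; (355) BY NAME; [folklore])

Cell `pub-balaban`, sub-cell `t4`, spine estimate NE7b (`T4WeightBudget.RelWeightBound`; the cell's OWN estimate — NOT PRINTED in
[Bałaban 1983–89], NOT PROVED).  Crux-route work under `Spine/NE7b/` by the row OWNER (`t4-ne7b-p1` gen 135, file (373)) under FREEZE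
(0)'s crux-prover clause, on `g134/records/SCOPING-d6-iteration.md` DECISION (d6′)(1); NOTHING of Bałaban's is named as a Lean object, valued or
asserted; no `T4Continuum/Support` leaf typed; no `def`, no notation; zero `sorry`.  Imports (BY NAME): the OWNER's (355) `…SupPolymerLocalStep`
(`step_exp_sum_support`); the tree's `rconnSubsets`, `mem_rconnSubsets`, `pushforwardActivity_apply`, `truncatedWeight_congr`, `pertZ`,
`cellActivity`; Mathlib's `Finset.sum_subset`, `Finset.Nonempty.subset_singleton_iff`.

WHAT IS PROVED ([folklore]; `𝒳|_D := 𝒳.filter (· ⊆ D)`, `L := 𝒫^{Touches R}(𝒳).image ⋃`, `L_D` the same for `𝒳|_D`, `z := ⋃_*M` from `𝒳`,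
`z_D` from `𝒳|_D`, for ANY activity functional `M` on families):
* §1 RESTRICTION COMBINATORICS: `rconnSubsets_restrict_subset`, `mem_rconnSubsets_restrict`, `image_restrict_subset`, `subset_of_mem_image_restrict`,
  `mem_image_restrict`, **`pushforward_restrict_eq`** (`z_D(Y') = z(Y')` for `Y' ⊆ D`), **`clusters_restrict_eq`** (the clusters of `L` with union
  `Y ⊆ D` are the clusters of `L_D` with union `Y`), `truncatedWeight_restrict_eq`, **`supportTerm_restrict_eq`** (`K⁺_Y[𝒳|_D] = K⁺_Y[𝒳]` for
  `Y ⊆ D`), `supportTerm_eq_zero_off` (`K⁺_Y[𝒳] = 0` for `Y ⊆ D` outside `𝒫(⋃𝒳|_D)`);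
* §2 THE RE-INDEXING IDENTITY **`sum_supportTerm_block_eq`** (displayed), and its blocked reading `image_eq_singleton_iff`,
  **`blockedSingletonTerm_eq`** (`Σ_{Y∈𝒫(⋃𝒳), B(Y)={p'}}K⁺_Y = Σ_{Y∈𝒫(⋃𝒳|_D)}K⁺_Y[𝒳|_D]` for the fibre `D` of `p'`);
* §3 THE END for the Gaussian road at small `ψ`: **`exp_sum_supportTerm_block_eq_pertZ`** and **`exp_blockedSingletonTerm_eq_pertZ`**
  (`exp(K'_{{p'}}(ψ)) = Z_ψ(𝒳|_{B⁻¹p'})`, smallness of `ψ` needed on the singleton members INSIDE the block only); §4 toy.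

HONEST (what this is NOT).  An identification (algebra + (355)); at LARGE `ψ` the KP logarithm is a junk value and only the right-hand side
(the unexpanded factor, (371)∕(372)) is meaningful — which is why the next scale's singleton data must be DEFINED as `Z_ψ(𝒳|_{blk p'}) − 1`; the
non-singleton blocked terms `K'(Y')`, `#Y' ≥ 2`, are NOT logarithms of restricted partition functions (they are genuinely cluster sums) and keep
(363)'s small-field sup letter; scalar skeleton ((A3), NC-NE7b-α UNRULED); nothing of Bałaban's asserted.  BY-NAME EFFECT ON THE WALL: NONE.
NE7b NOT PRINTED ∕ NOT PROVED; spine PROVED 0∕9; rung (B)+1 — the programme's measures remain FINITE-torus statements; NOT the mass gap, NOT Clay.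
HONEST DEPENDENCY: continuum YM on T⁴ ⇐ BetaPertH ∧ nine spine estimates (0∕9 proved); BetaPertH ⇐ (D1) ∧ (D4) ∧ CAP+tail; G-an2-4 gates asym,
D1 and NE2∕3∕4.
-/

set_option autoImplicit false

noncomputable section

namespace Summit.QuantumFields.BalabanUV.T4Continuum.NE7b.SupBlockSingletonUnexpanded

open MeasureTheory ProbabilityTheory Finset Real
open scoped BigOperators
open Literature.Probability.LatticeModels
open Literature.Analysis.Matrix (HasFiniteRange)
open SupPolymerLocalStep (step_exp_sum_support)

variable {V : Type*} [DecidableEq V] {R : V → V → Prop} [DecidableRel R] {nbr : V → Finset V} {Δ : ℕ}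

/-! ## §1. Restriction of the family to a block: families, polymers, activities, clusters, support terms -/

section Restrict

variable {S : Finset V → Finset V → Prop} (𝒳 : Finset (Finset V)) (D : Finset V)

omit [DecidableRel R] in
/-- The connected subfamilies of the restricted family are connected subfamilies of the family. [folklore] -/
theorem rconnSubsets_restrict_subset : rconnSubsets S (𝒳.filter fun X => X ⊆ D) ⊆ rconnSubsets S 𝒳 := fun 𝒜 h𝒜 => by
  obtain ⟨h1, h2⟩ := mem_rconnSubsets.1 h𝒜
  exact mem_rconnSubsets.2 ⟨h1.trans (filter_subset _ _), h2⟩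

omit [DecidableRel R] in
/-- **A connected subfamily with union inside `D` is a connected subfamily of the restricted family.** [folklore] -/
theorem mem_rconnSubsets_restrict {𝒜 : Finset (Finset V)} (h𝒜 : 𝒜 ∈ rconnSubsets S 𝒳) (hD : 𝒜.biUnion id ⊆ D) :
    𝒜 ∈ rconnSubsets S (𝒳.filter fun X => X ⊆ D) := by
  obtain ⟨h1, h2⟩ := mem_rconnSubsets.1 h𝒜
  refine mem_rconnSubsets.2 ⟨fun X hX => mem_filter.2 ⟨h1 hX, fun p hp => hD ?_⟩, h2⟩
  exact mem_biUnion.2 ⟨X, hX, by simpa using hp⟩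

omit [DecidableRel R] in
/-- The polymers of the restricted family are polymers of the family. [folklore] -/
theorem image_restrict_subset :
    ((rconnSubsets S (𝒳.filter fun X => X ⊆ D)).image fun 𝒜 : Finset (Finset V) => 𝒜.biUnion id) ⊆
      (rconnSubsets S 𝒳).image fun 𝒜 : Finset (Finset V) => 𝒜.biUnion id :=
  image_subset_image (rconnSubsets_restrict_subset 𝒳 D)

omit [DecidableRel R] in
/-- The polymers of the restricted family lie inside `D` and inside `⋃𝒳|_D`. [folklore] -/
theorem subset_of_mem_image_restrict {Y' : Finset V}
    (hY' : Y' ∈ (rconnSubsets S (𝒳.filter fun X => X ⊆ D)).image fun 𝒜 : Finset (Finset V) => 𝒜.biUnion id) :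
    Y' ⊆ D ∧ Y' ⊆ (𝒳.filter fun X => X ⊆ D).biUnion id := by
  obtain ⟨𝒜, h𝒜, rfl⟩ := mem_image.1 hY'
  have h1 := (mem_rconnSubsets.1 h𝒜).1
  refine ⟨biUnion_subset.2 fun X hX => ?_, biUnion_subset_biUnion_of_subset_left id h1⟩
  simpa using (mem_filter.1 (h1 hX)).2

omit [DecidableRel R] in
/-- **A polymer of the family inside `D` is a polymer of the restricted family.** [folklore] -/
theorem mem_image_restrict {Y' : Finset V} (hY' : Y' ∈ (rconnSubsets S 𝒳).image fun 𝒜 : Finset (Finset V) => 𝒜.biUnion id)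
    (hD : Y' ⊆ D) : Y' ∈ (rconnSubsets S (𝒳.filter fun X => X ⊆ D)).image fun 𝒜 : Finset (Finset V) => 𝒜.biUnion id := by
  obtain ⟨𝒜, h𝒜, rfl⟩ := mem_image.1 hY'
  exact mem_image.2 ⟨𝒜, mem_rconnSubsets_restrict 𝒳 D h𝒜 hD, rfl⟩

omit [DecidableRel R] in
/-- **THE RESUMMED ACTIVITIES AGREE INSIDE THE BLOCK**: `z_D(Y') = z(Y')` for `Y' ⊆ D` (the families with union `Y'` are the same). [folklore] -/
theorem pushforward_restrict_eq (M : Finset (Finset V) → ℂ) {Y' : Finset V} (hD : Y' ⊆ D) :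
    pushforwardActivity (fun 𝒜 : Finset (Finset V) => 𝒜.biUnion id) M (rconnSubsets S (𝒳.filter fun X => X ⊆ D)) Y' =
      pushforwardActivity (fun 𝒜 : Finset (Finset V) => 𝒜.biUnion id) M (rconnSubsets S 𝒳) Y' := by
  rw [pushforwardActivity_apply, pushforwardActivity_apply]
  refine sum_congr ?_ fun _ _ => rfl
  ext 𝒜
  simp only [mem_filter]
  constructor
  · rintro ⟨h𝒜, hU⟩; exact ⟨rconnSubsets_restrict_subset 𝒳 D h𝒜, hU⟩
  · rintro ⟨h𝒜, hU⟩; exact ⟨mem_rconnSubsets_restrict 𝒳 D h𝒜 ((subset_of_eq hU).trans hD), hU⟩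

omit [DecidableRel R] in
/-- **THE CLUSTERS WITH UNION INSIDE THE BLOCK ARE THE CLUSTERS OF THE RESTRICTED GAS**: for `Y ⊆ D`,
`{𝒞 ⊆ L : ⋃𝒞 = Y} = {𝒞 ⊆ L_D : ⋃𝒞 = Y}`. [folklore] -/
theorem clusters_restrict_eq {Y : Finset V} (hD : Y ⊆ D) :
    (((rconnSubsets S 𝒳).image fun 𝒜 : Finset (Finset V) => 𝒜.biUnion id).powerset.filter
        fun 𝒞 : Finset (Finset V) => 𝒞.biUnion id = Y) =
      (((rconnSubsets S (𝒳.filter fun X => X ⊆ D)).image fun 𝒜 : Finset (Finset V) => 𝒜.biUnion id).powerset.filter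
        fun 𝒞 : Finset (Finset V) => 𝒞.biUnion id = Y) := by
  ext 𝒞
  simp only [mem_filter, mem_powerset]
  constructor
  · rintro ⟨h𝒞, hU⟩
    refine ⟨fun Y' hY' => mem_image_restrict 𝒳 D (h𝒞 hY') ?_, hU⟩
    exact (subset_biUnion_of_mem id hY').trans ((subset_of_eq hU).trans hD)
  · rintro ⟨h𝒞, hU⟩
    exact ⟨h𝒞.trans (image_restrict_subset 𝒳 D), hU⟩

/-- The truncated functionals of clusters of the restricted gas agree for `z_D` and `z`. [folklore] -/
theorem truncatedWeight_restrict_eq (M : Finset (Finset V) → ℂ) {𝒞 : Finset (Finset V)}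
    (h𝒞 : 𝒞 ⊆ (rconnSubsets (Touches R) (𝒳.filter fun X => X ⊆ D)).image fun 𝒜 : Finset (Finset V) => 𝒜.biUnion id) :
    truncatedWeight (GeomInc R)
        (pushforwardActivity (fun 𝒜 : Finset (Finset V) => 𝒜.biUnion id) M (rconnSubsets (Touches R) (𝒳.filter fun X => X ⊆ D))) 𝒞 =
      truncatedWeight (GeomInc R) (pushforwardActivity (fun 𝒜 : Finset (Finset V) => 𝒜.biUnion id) M (rconnSubsets (Touches R) 𝒳)) 𝒞 :=
  truncatedWeight_congr fun _ hY' => pushforward_restrict_eq 𝒳 D M (subset_of_mem_image_restrict 𝒳 D (h𝒞 hY')).1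

/-- **THE SUPPORT TERMS INSIDE THE BLOCK ARE THOSE OF THE RESTRICTED FAMILY**: `Y ⊆ D` ⟹ `K⁺_Y[𝒳|_D] = K⁺_Y[𝒳]`. [folklore] -/
theorem supportTerm_restrict_eq (M : Finset (Finset V) → ℂ) {Y : Finset V} (hD : Y ⊆ D) :
    ∑ 𝒞 ∈ ((rconnSubsets (Touches R) (𝒳.filter fun X => X ⊆ D)).image fun 𝒜 : Finset (Finset V) => 𝒜.biUnion id).powerset
        with 𝒞.biUnion id = Y,
        truncatedWeight (GeomInc R) (pushforwardActivity (fun 𝒜 : Finset (Finset V) => 𝒜.biUnion id) M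
          (rconnSubsets (Touches R) (𝒳.filter fun X => X ⊆ D))) 𝒞 =
      ∑ 𝒞 ∈ ((rconnSubsets (Touches R) 𝒳).image fun 𝒜 : Finset (Finset V) => 𝒜.biUnion id).powerset with 𝒞.biUnion id = Y,
        truncatedWeight (GeomInc R) (pushforwardActivity (fun 𝒜 : Finset (Finset V) => 𝒜.biUnion id) M (rconnSubsets (Touches R) 𝒳)) 𝒞 := by
  rw [clusters_restrict_eq 𝒳 D hD]
  exact sum_congr rfl fun 𝒞 h𝒞 => truncatedWeight_restrict_eq 𝒳 D M (mem_powerset.1 (mem_filter.1 h𝒞).1)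

/-- **SUPPORT TERMS INSIDE THE BLOCK BUT OFF `𝒫(⋃𝒳|_D)` VANISH** (no cluster has such a union: clusters with union inside `D` are clusters of
the restricted gas, whose unions lie in `⋃𝒳|_D` and are `R`-connected). [folklore] -/
theorem supportTerm_eq_zero_off (M : Finset (Finset V) → ℂ) {Y : Finset V} (hD : Y ⊆ D) (hYconn : IsRConnected R Y)
    (hY : Y ∉ rconnSubsets R ((𝒳.filter fun X => X ⊆ D).biUnion id)) :
    ∑ 𝒞 ∈ ((rconnSubsets (Touches R) 𝒳).image fun 𝒜 : Finset (Finset V) => 𝒜.biUnion id).powerset with 𝒞.biUnion id = Y,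
        truncatedWeight (GeomInc R) (pushforwardActivity (fun 𝒜 : Finset (Finset V) => 𝒜.biUnion id) M (rconnSubsets (Touches R) 𝒳)) 𝒞 = 0 := by
  rw [clusters_restrict_eq 𝒳 D hD]
  refine sum_eq_zero fun 𝒞 h𝒞 => ?_
  exfalso
  obtain ⟨h𝒞L, hU⟩ := mem_filter.1 h𝒞
  refine hY (mem_rconnSubsets.2 ⟨?_, hYconn⟩)
  rw [← hU]
  exact biUnion_subset.2 fun Y' hY' => by
    simpa using (subset_of_mem_image_restrict 𝒳 D (mem_powerset.1 h𝒞L hY')).2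

end Restrict

/-! ## §2. The re-indexing identity and its blocked reading -/

/-- **THE RE-INDEXING IDENTITY**: for every family `𝒳`, block `D` and activity functional `M`,
`Σ_{Y ∈ 𝒫(⋃𝒳), Y ⊆ D} K⁺_Y[𝒳] = Σ_{Y ∈ 𝒫(⋃𝒳|_D)} K⁺_Y[𝒳|_D]`. [folklore] -/
theorem sum_supportTerm_block_eq (𝒳 : Finset (Finset V)) (D : Finset V) (M : Finset (Finset V) → ℂ) :
    ∑ Y ∈ rconnSubsets R (𝒳.biUnion id) with Y ⊆ D,
        ∑ 𝒞 ∈ ((rconnSubsets (Touches R) 𝒳).image fun 𝒜 : Finset (Finset V) => 𝒜.biUnion id).powerset with 𝒞.biUnion id = Y,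
          truncatedWeight (GeomInc R) (pushforwardActivity (fun 𝒜 : Finset (Finset V) => 𝒜.biUnion id) M (rconnSubsets (Touches R) 𝒳)) 𝒞 =
      ∑ Y ∈ rconnSubsets R ((𝒳.filter fun X => X ⊆ D).biUnion id),
        ∑ 𝒞 ∈ ((rconnSubsets (Touches R) (𝒳.filter fun X => X ⊆ D)).image fun 𝒜 : Finset (Finset V) => 𝒜.biUnion id).powerset
          with 𝒞.biUnion id = Y,
          truncatedWeight (GeomInc R) (pushforwardActivity (fun 𝒜 : Finset (Finset V) => 𝒜.biUnion id) M
            (rconnSubsets (Touches R) (𝒳.filter fun X => X ⊆ D))) 𝒞 := by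
  -- the right-hand index set lies inside the left-hand one, and the extra terms vanish
  have hUD : (𝒳.filter fun X => X ⊆ D).biUnion id ⊆ D := biUnion_subset.2 fun X hX => by simpa using (mem_filter.1 hX).2
  have hU𝒳 : (𝒳.filter fun X => X ⊆ D).biUnion id ⊆ 𝒳.biUnion id := biUnion_subset_biUnion_of_subset_left id (filter_subset _ _)
  have hsub : rconnSubsets R ((𝒳.filter fun X => X ⊆ D).biUnion id) ⊆ (rconnSubsets R (𝒳.biUnion id)).filter fun Y => Y ⊆ D := by
    intro Y hY
    obtain ⟨h1, h2⟩ := mem_rconnSubsets.1 hY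
    exact mem_filter.2 ⟨mem_rconnSubsets.2 ⟨h1.trans hU𝒳, h2⟩, h1.trans hUD⟩
  symm
  rw [← sum_subset hsub]
  · exact sum_congr rfl fun Y hY => supportTerm_restrict_eq 𝒳 D M ((mem_rconnSubsets.1 hY).1.trans hUD)
  · intro Y hY hYoff
    obtain ⟨hYT, hYD⟩ := mem_filter.1 hY
    exact supportTerm_eq_zero_off 𝒳 D M hYD (mem_rconnSubsets.1 hYT).2 hYoff

omit [DecidableEq V] [DecidableRel R] in
/-- A nonempty cell set blocks to the single block `p'` iff all its cells lie in the fibre of `p'`. [folklore] -/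
theorem image_eq_singleton_iff {W : Type*} [DecidableEq W] (B : V → W) {Y : Finset V} (hY : Y.Nonempty) (p' : W) :
    Y.image B = {p'} ↔ ∀ q ∈ Y, B q = p' := by
  rw [← (hY.image B).subset_singleton_iff]
  constructor
  · intro h q hq; exact mem_singleton.1 (h (mem_image_of_mem B hq))
  · intro h w hw
    obtain ⟨q, hq, rfl⟩ := mem_image.1 hw
    exact mem_singleton.2 (h q hq)

/-- **THE BLOCKED SINGLETON TERM RE-INDEXED**: for the fibre `D` of `p'` (`q ∈ D ↔ B q = p'`), (367)'s blocked term at the singleton `{p'}`,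
`K'({p'}) = Σ_{Y ∈ 𝒫(⋃𝒳), B(Y) = {p'}} K⁺_Y[𝒳]`, equals `Σ_{Y ∈ 𝒫(⋃𝒳|_D)} K⁺_Y[𝒳|_D]`. [folklore] -/
theorem blockedSingletonTerm_eq {W : Type*} [DecidableEq W] (B : V → W) (p' : W) (𝒳 : Finset (Finset V)) (D : Finset V)
    (hD : ∀ q, q ∈ D ↔ B q = p') (M : Finset (Finset V) → ℂ) :
    ∑ Y ∈ rconnSubsets R (𝒳.biUnion id) with Y.image B = {p'},
        ∑ 𝒞 ∈ ((rconnSubsets (Touches R) 𝒳).image fun 𝒜 : Finset (Finset V) => 𝒜.biUnion id).powerset with 𝒞.biUnion id = Y,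
          truncatedWeight (GeomInc R) (pushforwardActivity (fun 𝒜 : Finset (Finset V) => 𝒜.biUnion id) M (rconnSubsets (Touches R) 𝒳)) 𝒞 =
      ∑ Y ∈ rconnSubsets R ((𝒳.filter fun X => X ⊆ D).biUnion id),
        ∑ 𝒞 ∈ ((rconnSubsets (Touches R) (𝒳.filter fun X => X ⊆ D)).image fun 𝒜 : Finset (Finset V) => 𝒜.biUnion id).powerset
          with 𝒞.biUnion id = Y,
          truncatedWeight (GeomInc R) (pushforwardActivity (fun 𝒜 : Finset (Finset V) => 𝒜.biUnion id) M
            (rconnSubsets (Touches R) (𝒳.filter fun X => X ⊆ D))) 𝒞 := by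
  rw [← sum_supportTerm_block_eq 𝒳 D M]
  refine sum_congr (filter_congr fun Y hY => ?_) fun _ _ => rfl
  rw [image_eq_singleton_iff B (mem_rconnSubsets.1 hY).2.1 p']
  exact ⟨fun h q hq => (hD q).2 (h q hq), fun h q hq => (hD q).1 (h hq)⟩

/-! ## §3. THE END for the Gaussian road at small external field -/

section Gaussian

variable {ι : Type} [Fintype ι] [DecidableEq ι]

/-- **`exp(Σ_{Y ∈ 𝒫(⋃𝒳), Y ⊆ D} K⁺_Y(ψ)) = Z_ψ(𝒳|_D)`**: the hypotheses of (355)'s step for the members of `𝒳` INSIDE `D` (connected,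
cell-measurable, singletons regulated, the others sup-small; the Gaussian road; `ψ` small on the singleton members inside `D`;
`e·ε′·(Δ+1)² ≤ 1∕2`) ⟹ the displayed identity. [folklore] -/
theorem exp_sum_supportTerm_block_eq_pertZ {Γ : Matrix ι ι ℝ} {γop γ : ℝ} (hΓ : Γ.PosSemidef)
    (hΓop : (γop • (1 : Matrix ι ι ℝ) - Γ).PosSemidef) (hdiag : ∀ i, Γ i i ≤ γ) (hγ : 0 ≤ γ) {dι : ι → ι → ℕ} {ρ : ℕ}
    (hfr : HasFiniteRange dι ρ Γ) (cell : V → Finset ι) (hdisj : ∀ p q, p ≠ q → Disjoint (cell p) (cell q)) {v : ℕ}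
    (hv : ∀ p, (cell p).card ≤ v) (hRsymm : ∀ x y, R x y → R y x)
    (hR : ∀ (p p' : V) (x y : ι), x ∈ cell p → y ∈ cell p' → dι x y ≤ ρ → p = p' ∨ R p p')
    (hΔ : ∀ x, (nbr x).card ≤ Δ) (hnbr : ∀ x y, R x y → y ∈ nbr x)
    {f : Finset V → EuclideanSpace ℝ ι → ℂ} {ε κ τ θ Ψ : ℝ} (hε : 0 ≤ ε) (hκ : 0 ≤ κ) (hτ : 0 < τ) (hθ0 : 0 < θ) (hθ1 : θ < 1)
    (hκθ : κ * (1 + τ) * γop ≤ θ) (𝒳 : Finset (Finset V)) (D : Finset V) (hconn : ∀ X ∈ 𝒳, X ⊆ D → IsRConnected R X)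
    (hmeas : ∀ X ∈ 𝒳, X ⊆ D →
      Measurable[⨆ p ∈ X, MeasurableSpace.comap (fun (ω : EuclideanSpace ℝ ι) (x : cell p) => ω x) inferInstance] (f X))
    (hreg : ∀ X ∈ 𝒳, X ⊆ D → X.card = 1 → ∀ ω : EuclideanSpace ℝ ι, ‖f X ω‖ ≤ ε ^ X.card * exp (κ * (∑ x ∈ X.biUnion cell, ω x ^ 2) / 2))
    (hsup : ∀ X ∈ 𝒳, X ⊆ D → X.card ≠ 1 → ∀ ω : EuclideanSpace ℝ ι, ‖f X ω‖ ≤ ε ^ X.card) (ψ : EuclideanSpace ℝ ι)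
    (hψ : ∀ X ∈ 𝒳, X ⊆ D → X.card = 1 → ∑ x ∈ X.biUnion cell, ψ x ^ 2 ≤ Ψ ^ 2)
    (hsmall : Real.exp 1 * (Real.sqrt ((ε * exp (κ * (1 + τ⁻¹) * Ψ ^ 2 / 2)) * ((1 - θ) ^ (-(κ * (1 + τ) * γ / (2 * θ)))) ^ v) *
      Real.exp (2 * Real.sqrt ((ε * exp (κ * (1 + τ⁻¹) * Ψ ^ 2 / 2)) * ((1 - θ) ^ (-(κ * (1 + τ) * γ / (2 * θ)))) ^ v))) *
      ((Δ : ℝ) + 1) ^ 2 ≤ 1 / 2) :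
    Complex.exp (∑ Y ∈ rconnSubsets R (𝒳.biUnion id) with Y ⊆ D,
        ∑ 𝒞 ∈ ((rconnSubsets (Touches R) 𝒳).image fun 𝒜 : Finset (Finset V) => 𝒜.biUnion id).powerset with 𝒞.biUnion id = Y,
          truncatedWeight (GeomInc R) (pushforwardActivity (fun 𝒜 : Finset (Finset V) => 𝒜.biUnion id)
            (cellActivity (multivariateGaussian 0 Γ) fun X ω => f X (ω + ψ)) (rconnSubsets (Touches R) 𝒳)) 𝒞) =
      pertZ (multivariateGaussian 0 Γ) (fun X ω => f X (ω + ψ)) (𝒳.filter fun X => X ⊆ D) := by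
  rw [sum_supportTerm_block_eq 𝒳 D]
  exact step_exp_sum_support hΓ hΓop hdiag hγ hfr cell hdisj hv hRsymm hR hΔ hnbr hε hκ hτ hθ0 hθ1 hκθ (𝒳.filter fun X => X ⊆ D)
    (fun X hX => hconn X (mem_filter.1 hX).1 (mem_filter.1 hX).2) (fun X hX => hmeas X (mem_filter.1 hX).1 (mem_filter.1 hX).2)
    (fun X hX => hreg X (mem_filter.1 hX).1 (mem_filter.1 hX).2) (fun X hX => hsup X (mem_filter.1 hX).1 (mem_filter.1 hX).2) ψ
    (fun X hX => hψ X (mem_filter.1 hX).1 (mem_filter.1 hX).2) hsmall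

/-- **THE END — THE NEXT SINGLETON MAYER FACTOR OF THE BLOCKED LEDGER IS THE UNEXPANDED SINGLE-BLOCK FACTOR**: for a blocking map `B` and the
fibre `D` of the block `p'`, under the hypotheses of `exp_sum_supportTerm_block_eq_pertZ`:
`exp(Σ_{Y ∈ 𝒫(⋃𝒳), B(Y) = {p'}} K⁺_Y(ψ)) = Z_ψ(𝒳|_D)`, i.e. `e^{K'_{{p'}}(ψ)} − 1 = g⁺_{p'}(ψ)`. [folklore] -/
theorem exp_blockedSingletonTerm_eq_pertZ {Γ : Matrix ι ι ℝ} {γop γ : ℝ} (hΓ : Γ.PosSemidef)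
    (hΓop : (γop • (1 : Matrix ι ι ℝ) - Γ).PosSemidef) (hdiag : ∀ i, Γ i i ≤ γ) (hγ : 0 ≤ γ) {dι : ι → ι → ℕ} {ρ : ℕ}
    (hfr : HasFiniteRange dι ρ Γ) (cell : V → Finset ι) (hdisj : ∀ p q, p ≠ q → Disjoint (cell p) (cell q)) {v : ℕ}
    (hv : ∀ p, (cell p).card ≤ v) (hRsymm : ∀ x y, R x y → R y x)
    (hR : ∀ (p p' : V) (x y : ι), x ∈ cell p → y ∈ cell p' → dι x y ≤ ρ → p = p' ∨ R p p')
    (hΔ : ∀ x, (nbr x).card ≤ Δ) (hnbr : ∀ x y, R x y → y ∈ nbr x)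
    {f : Finset V → EuclideanSpace ℝ ι → ℂ} {ε κ τ θ Ψ : ℝ} (hε : 0 ≤ ε) (hκ : 0 ≤ κ) (hτ : 0 < τ) (hθ0 : 0 < θ) (hθ1 : θ < 1)
    (hκθ : κ * (1 + τ) * γop ≤ θ) (𝒳 : Finset (Finset V)) {W : Type*} [DecidableEq W] (B : V → W) (p' : W) (D : Finset V)
    (hD : ∀ q, q ∈ D ↔ B q = p') (hconn : ∀ X ∈ 𝒳, X ⊆ D → IsRConnected R X)
    (hmeas : ∀ X ∈ 𝒳, X ⊆ D →
      Measurable[⨆ p ∈ X, MeasurableSpace.comap (fun (ω : EuclideanSpace ℝ ι) (x : cell p) => ω x) inferInstance] (f X))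
    (hreg : ∀ X ∈ 𝒳, X ⊆ D → X.card = 1 → ∀ ω : EuclideanSpace ℝ ι, ‖f X ω‖ ≤ ε ^ X.card * exp (κ * (∑ x ∈ X.biUnion cell, ω x ^ 2) / 2))
    (hsup : ∀ X ∈ 𝒳, X ⊆ D → X.card ≠ 1 → ∀ ω : EuclideanSpace ℝ ι, ‖f X ω‖ ≤ ε ^ X.card) (ψ : EuclideanSpace ℝ ι)
    (hψ : ∀ X ∈ 𝒳, X ⊆ D → X.card = 1 → ∑ x ∈ X.biUnion cell, ψ x ^ 2 ≤ Ψ ^ 2)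
    (hsmall : Real.exp 1 * (Real.sqrt ((ε * exp (κ * (1 + τ⁻¹) * Ψ ^ 2 / 2)) * ((1 - θ) ^ (-(κ * (1 + τ) * γ / (2 * θ)))) ^ v) *
      Real.exp (2 * Real.sqrt ((ε * exp (κ * (1 + τ⁻¹) * Ψ ^ 2 / 2)) * ((1 - θ) ^ (-(κ * (1 + τ) * γ / (2 * θ)))) ^ v))) *
      ((Δ : ℝ) + 1) ^ 2 ≤ 1 / 2) :
    Complex.exp (∑ Y ∈ rconnSubsets R (𝒳.biUnion id) with Y.image B = {p'},
        ∑ 𝒞 ∈ ((rconnSubsets (Touches R) 𝒳).image fun 𝒜 : Finset (Finset V) => 𝒜.biUnion id).powerset with 𝒞.biUnion id = Y,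
          truncatedWeight (GeomInc R) (pushforwardActivity (fun 𝒜 : Finset (Finset V) => 𝒜.biUnion id)
            (cellActivity (multivariateGaussian 0 Γ) fun X ω => f X (ω + ψ)) (rconnSubsets (Touches R) 𝒳)) 𝒞) - 1 =
      pertZ (multivariateGaussian 0 Γ) (fun X ω => f X (ω + ψ)) (𝒳.filter fun X => X ⊆ D) - 1 := by
  rw [blockedSingletonTerm_eq B p' 𝒳 D hD, ← sum_supportTerm_block_eq 𝒳 D,
    exp_sum_supportTerm_block_eq_pertZ hΓ hΓop hdiag hγ hfr cell hdisj hv hRsymm hR hΔ hnbr hε hκ hτ hθ0 hθ1 hκθ 𝒳 D hconn hmeas hreg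
      hsup ψ hψ hsmall]

end Gaussian

/-! ## §4. Toy -/

omit [DecidableRel R] in
/-- Toy (§2): on `Fin 3` blocked to `Fin 1` by the constant map, `{0, 2}` blocks to `{0}`. -/
example : (({0, 2} : Finset (Fin 3)).image (fun _ : Fin 3 => (0 : Fin 1))) = {0} :=
  (image_eq_singleton_iff (fun _ : Fin 3 => (0 : Fin 1)) (by simp) 0).2 fun _ _ => rfl

end Summit.QuantumFields.BalabanUV.T4Continuum.NE7b.SupBlockSingletonUnexpanded
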